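import Summits.RiemannHypothesis.RiemannHypothesis.Theorems.IntegerScrewCensusFloor112B

/-!
# Route `IntegerScrew` — census cell `M112-T440-dd` in the kernel: the DUAL checker on the cells `35 ≤ c < 59` (part C)

KERNEL FACTS (`decide +kernel`): `dualCheckW 111 440 40 EB 6000 a b … = true` on sub-ranges of `[35, 59)` for the dual
certificate literal `dpats112/deps112` of `IntegerScrewCensusFloor112A`.  RH-free; nothing here bears on the truth of RH.
-/

set_option linter.dupNamespace false
set_option autoImplicit false

namespace Summit.RiemannHypothesis.RiemannHypothesis.Theorems.IntegerScrew.Manifest.Fast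

open Literature.Analysis.ValidatedNumerics Literature.Analysis.ValidatedNumerics.Numerics

set_option maxRecDepth 200000 in
set_option maxHeartbeats 0 in
/-- KERNEL FACT: the cells `35 ≤ c < 43` pass. -/
theorem dualCheckW_112_35_43 : dualCheckW 111 440 40 EB 6000 35 43 logs113s dpats112 deps112 = true := by
  decide +kernel

set_option maxRecDepth 200000 in
set_option maxHeartbeats 0 in
/-- KERNEL FACT: the cells `43 ≤ c < 51` pass. -/
theorem dualCheckW_112_43_51 : dualCheckW 111 440 40 EB 6000 43 51 logs113s dpats112 deps112 = true := by
  decide +kernel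

set_option maxRecDepth 200000 in
set_option maxHeartbeats 0 in
/-- KERNEL FACT: the cells `51 ≤ c < 59` pass. -/
theorem dualCheckW_112_51_59 : dualCheckW 111 440 40 EB 6000 51 59 logs113s dpats112 deps112 = true := by
  decide +kernel

end Summit.RiemannHypothesis.RiemannHypothesis.Theorems.IntegerScrew.Manifest.Fast
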